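import Mathlib
import HarnessLib
import Summits.NavierStokesRegularity.NavierStokesRegularity.Theorems.PoloidalWindowRigidity.Negative.CellField

/-!
# Item `LrcModEntire` (stmt-NavierStokesRegularity-20428) — negative side: the THICK (NON-FROZEN) COLUMN, I: data,
# field, vorticity pattern (definitions and calculus)

Negative-side support (refuter seat ns-regularity-refuter1; D-0081 §C).  The registered skeleton twist-split v3 of the
item splits its twisting branch into `stub_twistingTH` (slope a function of time and height; FALSE without the
Oseen-mild identity (M) by the twisted (TH) column, `…Negative.TwistingTHFalseWithoutMild`) and `stub_twistingThick`
(the slope is a function of `(t, x₂)` on NO open subset of the window).  This file and its sequels show that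
`stub_twistingThick` is ALSO false once (M) is deleted, by an elementary witness on which NO shear slope exists at all:
the two vertical modes of
  `V(x) = (sin x₂ sin x₀, 2 sin(2x₂) sin x₁, cos x₂ cos x₀ + cos(2x₂) cos x₁)`
have the incompatible slopes `−1` and `−4` (`∂₂V₀ = −(−1)·(−∂₀V₂)`-type relations), so `∂₂ v_b = m ∂_b v₂` fails for
one of `b = 0, 1` at EVERY point of the window, whatever `m`.  The field is divergence-free, poloidal along `e₂`,
bounded (`‖V‖ ≤ 10`), entire real-analytic, and NOT frozen.  Here: the one-variable data `P = cos`, `Q = cos(2·)`,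
`P₁ = P' = −sin`, `Q₁ = Q' = −2 sin(2·)` with `P₁' = −P`, `Q₁' = −4Q`; the field `thickField`, its derivative
`thickDeriv`, the vorticity pattern `thickVort = curl V = (−5Q(x₂) sin x₁, 2P(x₂) sin x₀, 0)` and its derivative, the
profile `thickProfile t x = (−t)^{-1/2} V(x)` and the window.  Pattern and notation follow the accepted siblings
`…Negative.TwistedColumnODE/Field`.
WHAT THIS IS NOT: not a claim about Navier–Stokes regularity — explicit vector calculus for a kinematic witness. [folklore]
-/

noncomputable section

-- the summit and its single sub-problem share the name (CONVENTIONS §1), as in every Theorems file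
set_option linter.dupNamespace false

namespace Summit.NavierStokesRegularity.NavierStokesRegularity.Theorems.LrcModEntire.Negative

open Set Function Filter Topology
open Summit.NavierStokesRegularity.NavierStokesRegularity.Theorems.PoloidalWindowRigidity.Negative

local notation "E3" => EuclideanSpace ℝ (Fin 3)
local notation "π" i => (EuclideanSpace.proj (𝕜 := ℝ) (i : Fin 3) : EuclideanSpace ℝ (Fin 3) →L[ℝ] ℝ)
local notation "𝐞" i => (EuclideanSpace.single (i : Fin 3) (1 : ℝ) : EuclideanSpace ℝ (Fin 3))

/-! ## The one-variable data -/

/-- `P(h) = cos h` (vertical mode of slope `−1`). [folklore] -/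
def thickP (h : ℝ) : ℝ := Real.cos h

/-- `Q(h) = cos 2h` (vertical mode of slope `−4`). [folklore] -/
def thickQ (h : ℝ) : ℝ := Real.cos (2 * h)

/-- `P₁ = P' = −sin`. [folklore] -/
def thickP₁ (h : ℝ) : ℝ := -Real.sin h

/-- `Q₁ = Q' = −2 sin 2h`. [folklore] -/
def thickQ₁ (h : ℝ) : ℝ := -(2 * Real.sin (2 * h))

/-- `P' = P₁`. [folklore] -/
theorem hasDerivAt_thickP (h : ℝ) : HasDerivAt thickP (thickP₁ h) h := Real.hasDerivAt_cos h

/-- `Q' = Q₁`. [folklore] -/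
theorem hasDerivAt_thickQ (h : ℝ) : HasDerivAt thickQ (thickQ₁ h) h := by
  have H := (Real.hasDerivAt_cos (2 * h)).comp h ((hasDerivAt_id h).const_mul 2)
  refine (H.congr_deriv ?_)
  rw [thickQ₁]; simp; ring

/-- `P₁' = −P` (slope `−1`). [folklore] -/
theorem hasDerivAt_thickP₁ (h : ℝ) : HasDerivAt thickP₁ (-thickP h) h := (Real.hasDerivAt_sin h).neg

/-- `Q₁' = −4Q` (slope `−4`). [folklore] -/
theorem hasDerivAt_thickQ₁ (h : ℝ) : HasDerivAt thickQ₁ (-(4 * thickQ h)) h := by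
  have H := ((Real.hasDerivAt_sin (2 * h)).comp h ((hasDerivAt_id h).const_mul 2)).const_mul 2
  refine (H.neg.congr_deriv ?_)
  rw [thickQ]; simp; ring

/-- `|P| ≤ 1`. [folklore] -/
theorem abs_thickP_le (h : ℝ) : |thickP h| ≤ 1 := Real.abs_cos_le_one h

/-- `|Q| ≤ 1`. [folklore] -/
theorem abs_thickQ_le (h : ℝ) : |thickQ h| ≤ 1 := Real.abs_cos_le_one _

/-- `|P₁| ≤ 4` (crudely). [folklore] -/
theorem abs_thickP₁_le (h : ℝ) : |thickP₁ h| ≤ 4 := by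
  rw [thickP₁, abs_neg]; exact (Real.abs_sin_le_one h).trans (by norm_num)

/-- `|Q₁| ≤ 4` (crudely). [folklore] -/
theorem abs_thickQ₁_le (h : ℝ) : |thickQ₁ h| ≤ 4 := by
  rw [thickQ₁, abs_neg, abs_mul, abs_two]
  have := Real.abs_sin_le_one (2 * h)
  linarith

/-- `P` is real-analytic. [folklore] -/
theorem analyticAt_thickP (h : ℝ) : AnalyticAt ℝ thickP h := Real.analyticAt_cos

/-- `Q` is real-analytic. [folklore] -/
theorem analyticAt_thickQ (h : ℝ) : AnalyticAt ℝ thickQ h :=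
  (Real.analyticAt_cos.comp (analyticAt_const.mul analyticAt_id) :)

/-- `P₁` is real-analytic. [folklore] -/
theorem analyticAt_thickP₁ (h : ℝ) : AnalyticAt ℝ thickP₁ h := Real.analyticAt_sin.neg

/-- `Q₁` is real-analytic. [folklore] -/
theorem analyticAt_thickQ₁ (h : ℝ) : AnalyticAt ℝ thickQ₁ h :=
  (analyticAt_const.mul (Real.analyticAt_sin.comp (analyticAt_const.mul analyticAt_id) :)).neg

/-- `P(0) = 1`. [folklore] -/
theorem thickP_zero : thickP 0 = 1 := Real.cos_zero

/-- `Q(0) = 1`. [folklore] -/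
theorem thickQ_zero : thickQ 0 = 1 := by rw [thickQ, mul_zero, Real.cos_zero]

/-- `P₁(0) = 0`. [folklore] -/
theorem thickP₁_zero : thickP₁ 0 = 0 := by rw [thickP₁, Real.sin_zero, neg_zero]

/-- `Q₁(0) = 0`. [folklore] -/
theorem thickQ₁_zero : thickQ₁ 0 = 0 := by rw [thickQ₁, mul_zero, Real.sin_zero, mul_zero, neg_zero]

/-- On the admissible heights `0 < h < 1/2`: `P > 0`. [folklore] -/
theorem thickP_pos {h : ℝ} (h0 : 0 < h) (h1 : h < 1 / 2) : 0 < thickP h :=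
  Real.cos_pos_of_mem_Ioo ⟨by linarith [Real.pi_gt_three], by linarith [Real.pi_gt_three]⟩

/-- On the admissible heights: `Q > 0`. [folklore] -/
theorem thickQ_pos {h : ℝ} (h0 : 0 < h) (h1 : h < 1 / 2) : 0 < thickQ h :=
  Real.cos_pos_of_mem_Ioo ⟨by linarith [Real.pi_gt_three], by linarith [Real.pi_gt_three]⟩

/-- On the admissible heights: `P₁ < 0`. [folklore] -/
theorem thickP₁_neg {h : ℝ} (h0 : 0 < h) (h1 : h < 1 / 2) : thickP₁ h < 0 :=
  neg_neg_of_pos (Real.sin_pos_of_pos_of_lt_pi h0 (by linarith [Real.pi_gt_three]))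

/-- **The twist Wronskian is positive on the admissible heights**: `P₁Q − Q₁P = sin h (2cos² h + 1) > 0`. [folklore] -/
theorem thickWronskian_pos {h : ℝ} (h0 : 0 < h) (h1 : h < 1 / 2) : 0 < thickP₁ h * thickQ h - thickQ₁ h * thickP h := by
  have hs : 0 < Real.sin h := Real.sin_pos_of_pos_of_lt_pi h0 (by linarith [Real.pi_gt_three])
  have e : thickP₁ h * thickQ h - thickQ₁ h * thickP h = Real.sin h * (2 * Real.cos h ^ 2 + 1) := by
    rw [thickP₁, thickQ, thickQ₁, thickP, Real.cos_two_mul, Real.sin_two_mul]; ring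
  rw [e]
  positivity

/-! ## The thick column field, its vorticity pattern, the profile and the window (definitions) -/

/-- The thick column `V(x) = (−P₁(x₂) sin x₀, −Q₁(x₂) sin x₁, P(x₂) cos x₀ + Q(x₂) cos x₁)`
`= (sin x₂ sin x₀, 2 sin(2x₂) sin x₁, cos x₂ cos x₀ + cos(2x₂) cos x₁)`. [folklore] -/
def thickField (x : E3) : E3 :=
  (-(thickP₁ (x 2) * Real.sin (x 0))) • (𝐞 0) + (-(thickQ₁ (x 2) * Real.sin (x 1))) • (𝐞 1) +
    (thickP (x 2) * Real.cos (x 0) + thickQ (x 2) * Real.cos (x 1)) • (𝐞 2)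

/-- The derivative `DV(x)`, as an explicit continuous linear map. [folklore] -/
def thickDeriv (x : E3) : E3 →L[ℝ] E3 :=
  (-(thickP₁ (x 2) • (Real.cos (x 0) • (π 0)) + Real.sin (x 0) • ((-thickP (x 2)) • (π 2)))).smulRight (𝐞 0) +
  (-(thickQ₁ (x 2) • (Real.cos (x 1) • (π 1)) + Real.sin (x 1) • ((-(4 * thickQ (x 2))) • (π 2)))).smulRight (𝐞 1) +
  ((thickP (x 2) • (-(Real.sin (x 0)) • (π 0)) + Real.cos (x 0) • (thickP₁ (x 2) • (π 2))) +
      (thickQ (x 2) • (-(Real.sin (x 1)) • (π 1)) + Real.cos (x 1) • (thickQ₁ (x 2) • (π 2)))).smulRight (𝐞 2)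

/-- The vorticity pattern `K(x) = (−5 Q(x₂) sin x₁, 2 P(x₂) sin x₀, 0)` (`curl V = K`). [folklore] -/
def thickVort (x : E3) : E3 :=
  (-(5 * thickQ (x 2) * Real.sin (x 1))) • (𝐞 0) + (2 * thickP (x 2) * Real.sin (x 0)) • (𝐞 1)

/-- The derivative `DK(x)`, as an explicit continuous linear map. [folklore] -/
def thickVortDeriv (x : E3) : E3 →L[ℝ] E3 :=
  (-((5 * thickQ (x 2)) • (Real.cos (x 1) • (π 1)) + Real.sin (x 1) • ((5 * thickQ₁ (x 2)) • (π 2)))).smulRight (𝐞 0) +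
  ((2 * thickP (x 2)) • (Real.cos (x 0) • (π 0)) + Real.sin (x 0) • ((2 * thickP₁ (x 2)) • (π 2))).smulRight (𝐞 1)

/-- The thick column profile `v(t, x) = (−t)^{-1/2} V(x)`. [folklore] -/
def thickProfile (t : ℝ) (x : E3) : E3 := cellAmp t • thickField x

/-- The derivative of `x ↦ ∂₂v₂(t, x) = (−t)^{-1/2}(P₁(x₂) cos x₀ + Q₁(x₂) cos x₁)`. [folklore] -/
def thickDzVzDeriv (t : ℝ) (x : E3) : E3 →L[ℝ] ℝ :=
  cellAmp t • ((thickP₁ (x 2) • (-(Real.sin (x 0)) • (π 0)) + Real.cos (x 0) • ((-thickP (x 2)) • (π 2))) +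
    (thickQ₁ (x 2) • (-(Real.sin (x 1)) • (π 1)) + Real.cos (x 1) • ((-(4 * thickQ (x 2))) • (π 2))))

/-- The space–time window `{t < 0} × {x | 0 < x₀ < π, 0 < x₁ < π, 0 < x₂ < 1/2}`. [folklore] -/
def thickWindow : Set (ℝ × E3) :=
  Set.Iio (0 : ℝ) ×ˢ {x : E3 | 0 < x 0 ∧ x 0 < Real.pi ∧ 0 < x 1 ∧ x 1 < Real.pi ∧ 0 < x 2 ∧ x 2 < 1 / 2}

/-! ## Calculus of the field and of the vorticity pattern -/

/-- `V` is differentiable with derivative `thickDeriv`. [folklore] -/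
theorem hasFDerivAt_thickField (x : E3) : HasFDerivAt thickField (thickDeriv x) x := by
  have h0 : HasFDerivAt (fun y : E3 => y 0) (π 0) x := (π 0).hasFDerivAt
  have h1 : HasFDerivAt (fun y : E3 => y 1) (π 1) x := (π 1).hasFDerivAt
  have h2 : HasFDerivAt (fun y : E3 => y 2) (π 2) x := (π 2).hasFDerivAt
  have hc0 := (Real.hasDerivAt_cos (x 0)).comp_hasFDerivAt x h0
  have hc1 := (Real.hasDerivAt_cos (x 1)).comp_hasFDerivAt x h1
  have hs0 := (Real.hasDerivAt_sin (x 0)).comp_hasFDerivAt x h0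
  have hs1 := (Real.hasDerivAt_sin (x 1)).comp_hasFDerivAt x h1
  have hP := (hasDerivAt_thickP (x 2)).comp_hasFDerivAt x h2
  have hQ := (hasDerivAt_thickQ (x 2)).comp_hasFDerivAt x h2
  have hP1 := (hasDerivAt_thickP₁ (x 2)).comp_hasFDerivAt x h2
  have hQ1 := (hasDerivAt_thickQ₁ (x 2)).comp_hasFDerivAt x h2
  have H := ((((hP1.mul hs0).neg).smul_const (𝐞 0)).add (((hQ1.mul hs1).neg).smul_const (𝐞 1))).add
    (((hP.mul hc0).add (hQ.mul hc1)).smul_const (𝐞 2))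
  exact H

/-- `DV = thickDeriv`. [folklore] -/
theorem fderiv_thickField (x : E3) : fderiv ℝ thickField x = thickDeriv x :=
  (hasFDerivAt_thickField x).fderiv

/-- `V` is continuous. [folklore] -/
theorem continuous_thickField : Continuous thickField := by
  have hd : Differentiable ℝ thickField := fun x => (hasFDerivAt_thickField x).differentiableAt
  exact hd.continuous

/-- `DV(x) w` in coordinates. [folklore] -/
theorem thickDeriv_apply (x w : E3) : thickDeriv x w =
    (-(thickP₁ (x 2) * (Real.cos (x 0) * w 0) + Real.sin (x 0) * ((-thickP (x 2)) * w 2))) • (𝐞 0) +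
    (-(thickQ₁ (x 2) * (Real.cos (x 1) * w 1) + Real.sin (x 1) * ((-(4 * thickQ (x 2))) * w 2))) • (𝐞 1) +
    ((thickP (x 2) * (-(Real.sin (x 0)) * w 0) + Real.cos (x 0) * (thickP₁ (x 2) * w 2)) +
      (thickQ (x 2) * (-(Real.sin (x 1)) * w 1) + Real.cos (x 1) * (thickQ₁ (x 2) * w 2))) • (𝐞 2) := by
  rfl

/-- The components of `V(x)`. [folklore] -/
theorem thickField_apply_zero (x : E3) : thickField x 0 = -(thickP₁ (x 2) * Real.sin (x 0)) := by
  simp [thickField]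

/-- The second component of `V(x)`. [folklore] -/
theorem thickField_apply_one (x : E3) : thickField x 1 = -(thickQ₁ (x 2) * Real.sin (x 1)) := by
  simp [thickField]

/-- The third component of `V(x)`. [folklore] -/
theorem thickField_apply_two (x : E3) :
    thickField x 2 = thickP (x 2) * Real.cos (x 0) + thickQ (x 2) * Real.cos (x 1) := by
  simp [thickField]

/-- The components of `DV(x) w`. [folklore] -/
theorem thickDeriv_apply_zero (x w : E3) : thickDeriv x w 0 =
    -(thickP₁ (x 2) * (Real.cos (x 0) * w 0) + Real.sin (x 0) * ((-thickP (x 2)) * w 2)) := by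
  rw [thickDeriv_apply]; simp

/-- The second component of `DV(x) w`. [folklore] -/
theorem thickDeriv_apply_one (x w : E3) : thickDeriv x w 1 =
    -(thickQ₁ (x 2) * (Real.cos (x 1) * w 1) + Real.sin (x 1) * ((-(4 * thickQ (x 2))) * w 2)) := by
  rw [thickDeriv_apply]; simp

/-- The third component of `DV(x) w`. [folklore] -/
theorem thickDeriv_apply_two (x w : E3) : thickDeriv x w 2 =
    (thickP (x 2) * (-(Real.sin (x 0)) * w 0) + Real.cos (x 0) * (thickP₁ (x 2) * w 2)) +
      (thickQ (x 2) * (-(Real.sin (x 1)) * w 1) + Real.cos (x 1) * (thickQ₁ (x 2) * w 2)) := by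
  rw [thickDeriv_apply]; simp

/-- `‖V(x)‖ ≤ 10`. [folklore] -/
theorem norm_thickField_le (x : E3) : ‖thickField x‖ ≤ 10 := by
  have hP1 := abs_thickP₁_le (x 2)
  have hQ1 := abs_thickQ₁_le (x 2)
  have hP := abs_thickP_le (x 2)
  have hQ := abs_thickQ_le (x 2)
  have hs0 := Real.abs_sin_le_one (x 0)
  have hs1 := Real.abs_sin_le_one (x 1)
  have hc0 := Real.abs_cos_le_one (x 0)
  have hc1 := Real.abs_cos_le_one (x 1)
  have e0 : ‖(𝐞 0)‖ = 1 := by simp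
  have e1 : ‖(𝐞 1)‖ = 1 := by simp
  have e2 : ‖(𝐞 2)‖ = 1 := by simp
  unfold thickField
  refine (norm_add_le _ _).trans ?_
  refine (add_le_add (norm_add_le _ _) le_rfl).trans ?_
  rw [norm_smul, norm_smul, norm_smul, e0, e1, e2, mul_one, mul_one, mul_one, Real.norm_eq_abs,
    Real.norm_eq_abs, Real.norm_eq_abs, abs_neg, abs_neg, abs_mul, abs_mul]
  have h1 : |thickP₁ (x 2)| * |Real.sin (x 0)| ≤ 4 := by
    nlinarith [abs_nonneg (thickP₁ (x 2)), abs_nonneg (Real.sin (x 0))]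
  have h2 : |thickQ₁ (x 2)| * |Real.sin (x 1)| ≤ 4 := by
    nlinarith [abs_nonneg (thickQ₁ (x 2)), abs_nonneg (Real.sin (x 1))]
  have h3 : |thickP (x 2) * Real.cos (x 0) + thickQ (x 2) * Real.cos (x 1)| ≤ 2 := by
    refine (abs_add_le _ _).trans ?_
    rw [abs_mul, abs_mul]
    nlinarith [abs_nonneg (thickP (x 2)), abs_nonneg (Real.cos (x 0)), abs_nonneg (thickQ (x 2)),
      abs_nonneg (Real.cos (x 1))]
  linarith

/-- `(−5Q)' = −5Q₁` along the height. [folklore] -/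
theorem hasDerivAt_five_mul_thickQ (h : ℝ) : HasDerivAt (fun h => 5 * thickQ h) (5 * thickQ₁ h) h :=
  (hasDerivAt_thickQ h).const_mul 5

/-- `(2P)' = 2P₁` along the height. [folklore] -/
theorem hasDerivAt_two_mul_thickP (h : ℝ) : HasDerivAt (fun h => 2 * thickP h) (2 * thickP₁ h) h :=
  (hasDerivAt_thickP h).const_mul 2

/-- `K` is differentiable with derivative `thickVortDeriv`. [folklore] -/
theorem hasFDerivAt_thickVort (x : E3) : HasFDerivAt thickVort (thickVortDeriv x) x := by
  have h0 : HasFDerivAt (fun y : E3 => y 0) (π 0) x := (π 0).hasFDerivAt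
  have h1 : HasFDerivAt (fun y : E3 => y 1) (π 1) x := (π 1).hasFDerivAt
  have h2 : HasFDerivAt (fun y : E3 => y 2) (π 2) x := (π 2).hasFDerivAt
  have hs0 := (Real.hasDerivAt_sin (x 0)).comp_hasFDerivAt x h0
  have hs1 := (Real.hasDerivAt_sin (x 1)).comp_hasFDerivAt x h1
  have hA := (hasDerivAt_five_mul_thickQ (x 2)).comp_hasFDerivAt x h2
  have hB := (hasDerivAt_two_mul_thickP (x 2)).comp_hasFDerivAt x h2
  have H := (((hA.mul hs1).neg).smul_const (𝐞 0)).add ((hB.mul hs0).smul_const (𝐞 1))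
  have e : thickVort = fun y : E3 =>
      (-(5 * thickQ (y 2) * Real.sin (y 1))) • (𝐞 0) + (2 * thickP (y 2) * Real.sin (y 0)) • (𝐞 1) := rfl
  rw [e]
  exact H

/-- `DK(x) w` in coordinates. [folklore] -/
theorem thickVortDeriv_apply (x w : E3) : thickVortDeriv x w =
    (-((5 * thickQ (x 2)) * (Real.cos (x 1) * w 1) + Real.sin (x 1) * ((5 * thickQ₁ (x 2)) * w 2))) • (𝐞 0) +
    ((2 * thickP (x 2)) * (Real.cos (x 0) * w 0) + Real.sin (x 0) * ((2 * thickP₁ (x 2)) * w 2)) • (𝐞 1) := by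
  rfl

/-- The first component of `DK(x) w`. [folklore] -/
theorem thickVortDeriv_apply_zero (x w : E3) : thickVortDeriv x w 0 =
    -((5 * thickQ (x 2)) * (Real.cos (x 1) * w 1) + Real.sin (x 1) * ((5 * thickQ₁ (x 2)) * w 2)) := by
  rw [thickVortDeriv_apply]; simp

/-- The second component of `DK(x) w`. [folklore] -/
theorem thickVortDeriv_apply_one (x w : E3) : thickVortDeriv x w 1 =
    (2 * thickP (x 2)) * (Real.cos (x 0) * w 0) + Real.sin (x 0) * ((2 * thickP₁ (x 2)) * w 2) := by
  rw [thickVortDeriv_apply]; simp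

/-- The third component of `DK(x) w` vanishes. [folklore] -/
theorem thickVortDeriv_apply_two (x w : E3) : thickVortDeriv x w 2 = 0 := by
  rw [thickVortDeriv_apply]; simp

end Summit.NavierStokesRegularity.NavierStokesRegularity.Theorems.LrcModEntire.Negative

end
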